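import Literature.AlgebraicGeometry.HodgeTheory.ConjugateClassesOfRealizeDeRham
import Literature.Algebra.Homology.DoubleComplexRowQuasiIso
import HarnessLib

/-!
# Grothendieck's Theorem 1′: reduction to the affine pieces of a cover

[topic AlgebraicGeometry/HodgeTheory]

Grothendieck, *On the de Rham cohomology of algebraic varieties* [Grothendieck1966, p. 96–97 (6)],
right after the statement of Theorem 1′ ("the homomorphism (5) `H•(X) → H•(X^h, ℂ)` is an
isomorphism"): «If `X` is affine, this reduces by (4) to theorem 1. In fact, we can reduce easily
theorem 1′ to theorem 1. To see this, take a covering `𝔘` of `X` by affine open sets `U_i`; then we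
get a convergent spectral sequence (6) `H•(X) ⇐ E₂^{p,q} = H^p(𝔘, ℋ^q)` … and an analogous
spectral sequence for `X^h` and the covering `𝔘^h` of `X^h` by the open subsets `U_i^h`. Now (5) is
associated to a homomorphism of spectral sequences, so we are reduced to prove we have isomorphisms
for the terms `E₂`, which will follow if we know that (5) is an isomorphism, when `X` is replaced
by any prescheme `U_{i₀} ∩ U_{i₁} ∩ … ∩ U_{i_p}`.»

This file proves that reduction in the tree's language, on the `E₁`-page (columns) instead of `E₂`,
for a smooth `ℂ`-scheme `X` with analytic model `A` and a family of opens `𝔘 = (U_i)` with AFFINE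
finite intersections `U_J` (`IsAffineCover`) charted by `C : CoverCharts X U`:

* the comparison (5) of `X` along `𝔘` is the realisation morphism of double complexes
  `CoverCharts.realizeHom A : Č(𝔘, Ω•_alg) → Č(𝔘^an, Ω•_smooth)` (`AlgebraicCechDeRhamRealization`)
  and its map on total cohomology `CoverCharts.realizeTotCohMap A n : Hⁿ(Tot Č(𝔘, Ω•_alg)) →
  Hⁿ(Tot Č(𝔘^an, Ω)) (≅ Hⁿ_dR(X^an; ℂ)` by the partition-of-unity edge isomorphism);
* (5) for the piece `U_J` on the analytic model `A.restrictOpen U_J` (`AnalyticModelOpenSubscheme`) is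
  Grothendieck's comparison map `deRhamComparison (A.restrictOpen (cechOpen U J)) (C.coord J) le_rfl k :
  H^k_dR(U_J) → H^k_dR(U_J^an; ℂ)` (`RegularFormRealization`);
* **`CoverCharts.bijective_realizeTotCohMap_of_forall_deRhamComparison_bijective`**: if (5) is
  bijective for every finite intersection `U_J` and every degree, then `realizeTotCohMap A n` is
  bijective for every `n` — the `p`-th column of `realizeHom` is the product over the `(p+1)`-tuples
  `J` of the comparison cochain maps of the pieces `U_J` read as local forms on `X^an`
  (`AnalyticModel.localRealize`, extension by zero from the open submanifold `ψ⁻¹ U_J(ℂ)`), so it is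
  a quasi-isomorphism (`CoverCharts.bijective_cohomologyMap_realize_of_forall_deRhamComparison_bijective`),
  and a morphism of first-quadrant double complexes which is a quasi-isomorphism on every column is
  one on the total complexes (`ADoubleComplex.Hom.bijective_totCohMap_of_cols`,
  [KashiwaraSchapira2006, Thm. 12.5.4] — the `E₁`-form of Grothendieck's "homomorphism of spectral
  sequences");
* `CoverCharts.bijective_realizeDeRham_of_forall_deRhamComparison_bijective` — hence the realisation
  map of Route P `realizeDeRham : Hⁿ(Tot Č(𝔘, Ω•_alg)) → Hⁿ(Ω•(X^an))` is bijective;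
* **`exists_isConjugateClass_of_forall_deRhamComparison_bijective`** — consequently, for `X` smooth
  PROJECTIVE, `σ`-conjugate classes exist in every degree (`IsConjugateClass`, the existence conjunct
  of `IsAbsoluteHodgeClass`, [CharlesSchnell2014Notes, §11.2.2 (11.2.3)]) as soon as Theorem 1′
  holds for the finitely many affine pieces `U_J` of ONE finite affine cover of `X`
  (`exists_isConjugateClass_of_surjective_realizeDeRham`, the torsor step of Route P): Grothendieck's
  named fact (G) for ALL smooth affine `Y` is replaced by Theorem 1′ on the `U_J`.

The bridge between the open piece `W = ψ⁻¹ O(ℂ) ⊆ X^an` as an open SUBMANIFOLD (the carrier of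
`A.restrictOpen O`, where `deRhamComparison` lives) and the LOCAL forms `smoothFormsOn W` of the
Čech–de Rham complex (forms on `X^an` smooth on `W`, zero off `W`) is restriction along
`Subtype.val` / extension by zero (`MForm.extendZero`, `RegularFormRealizationOnOpens`;
`isSmoothForm_pullback_subtypeVal_of_mem_smoothFormsOn`, `mextDeriv_pullback_subtypeVal_of_mem_smoothFormsOn`,
`sub_extendZero_eq_restr_mextDeriv`):
`AnalyticModel.mem_exactForms_of_regularFormRealize_mem_cexactSmoothForms` /
`exists_regularFormRealize_sub_mem_cexactSmoothForms` (Theorem 1′ injectivity / surjectivity read on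
cochains) and their local-form readings `AnalyticModel.eq_zero_of_realizeOn_eq_zero`,
`exists_d_eq_of_realizeOn_eq_restr_mextDeriv`, `exists_eq_realizeOn_of_restr_mextDeriv_eq_zero`,
`exists_sub_realizeOn_eq_restr_mextDeriv`.

Everything is proved; no definitions, no named facts (net debt 0). The hypothesis "Theorem 1′ on the
pieces" is a theorem binder (the shape of `deRhamComparison_bijective_of_model`,
`deRhamComparison_affineSpace_bijective`, `deRhamComparison_bijective_degree_zero`), not a
`def … : Prop`.

## References

* [Grothendieck1966] A. Grothendieck, *On the de Rham cohomology of algebraic varieties*, Publ. Math.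
  IHÉS 29 (1966), p. 96–97: Theorem 1′ and the reduction (6) to the affine pieces.
* [CattaniElZeinGriffithsLe2014] E. Cattani, F. El Zein, P. Griffiths, Lê D. T. (eds.), *Hodge
  Theory*, Princeton Math. Notes 49 (2014), Ch. 2 §2.9.2 (2.9.1)–(2.9.2), p. 109.
* [KashiwaraSchapira2006] M. Kashiwara, P. Schapira, *Categories and Sheaves*, Thm. 12.5.4.
* [CharlesSchnell2014Notes] F. Charles, C. Schnell, *Notes on absolute Hodge classes*, §11.2.2.
-/

noncomputable section

universe u

open scoped Manifold ContDiff Topology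
open Set Function CategoryTheory AlgebraicGeometry MvPolynomial TopologicalSpace
open Literature.Algebra.Homology Literature.Geometry.Kaehler Literature.NumberTheory.Transcendental
open Literature.AlgebraicGeometry.Motives Literature.AlgebraicGeometry.Motives.AffineDeRham

/-! ### Local forms on an open piece read on the open submanifold -/

namespace Literature.Geometry.Kaehler

section Submanifold

variable {E' : Type*} [NormedAddCommGroup E'] [NormedSpace ℝ E'] {F : Type*} [NormedAddCommGroup F]
  [NormedSpace ℝ F] {M : Type*} [TopologicalSpace M] [ChartedSpace E' M] [IsManifold 𝓘(ℝ, E') ∞ M]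
  {k : ℕ} {W : Opens M}

/-- A local form on the open `W` (smooth on `W`, zero off `W`), restricted to the open submanifold
`↥W`, is a smooth form there. [cite: WarnerGTM94, 2.22] -/
theorem isSmoothForm_pullback_subtypeVal_of_mem_smoothFormsOn {s : MForm 𝓘(ℝ, E') M F k}
    (hs : s ∈ smoothFormsOn 𝓘(ℝ, E') F (W : Set M) k) :
    IsSmoothForm (s.pullback 𝓘(ℝ, E') (Subtype.val : W → M)) :=
  fun w ↦ MForm.SmoothAt.pullback_subtypeVal (hs.1 (w : M) w.2)

/-- **`d` commutes with restriction to the open submanifold** for a local form on `W`: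
`d(s|_W) = (d_W s)|_W`. [cite: WarnerGTM94, Prop. 2.23] -/
theorem mextDeriv_pullback_subtypeVal_of_mem_smoothFormsOn {s : MForm 𝓘(ℝ, E') M F k}
    (hs : s ∈ smoothFormsOn 𝓘(ℝ, E') F (W : Set M) k) :
    mextDeriv (s.pullback 𝓘(ℝ, E') (Subtype.val : W → M)) =
      ((mextDeriv s).restr (W : Set M)).pullback 𝓘(ℝ, E') (Subtype.val : W → M) := by
  funext w
  ext v
  rw [mextDeriv_pullback_subtypeVal_apply (hs.1 (w : M) w.2), MForm.pullback_subtypeVal_apply,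
    MForm.restr_apply_of_mem _ w.2]

/-- **Extension by zero of an exactness relation on the open submanifold.** If on `↥W` the form `β`
differs from the restriction `s|_W` of a local form `s` on `W` by `dδ` with `δ` smooth, then on `M`
the local form `s` differs from the extension by zero of `β` by `d_W` of the local form `-(δ^ext)`:
`s - β^ext = (d(-δ^ext))|_W`. [cite: LeeSmoothManifolds2013, Lemma 2.26] [cite: WarnerGTM94, Prop. 2.23] -/
theorem sub_extendZero_eq_restr_mextDeriv {β : MForm 𝓘(ℝ, E') W F (k + 1)} {δ : MForm 𝓘(ℝ, E') W F k}
    (hδ : IsSmoothForm δ) {s : MForm 𝓘(ℝ, E') M F (k + 1)}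
    (hs : s ∈ smoothFormsOn 𝓘(ℝ, E') F (W : Set M) (k + 1))
    (h : β - s.pullback 𝓘(ℝ, E') (Subtype.val : W → M) = mextDeriv δ) :
    s - β.extendZero = (mextDeriv (-δ.extendZero)).restr (W : Set M) := by
  funext z
  by_cases hz : z ∈ W
  · ext v
    -- values at `v`; the tangent spaces `T_z M` and `T_⟨z,hz⟩ W` are both the model space `E'`
    have e1 : β.extendZero z v = β ⟨z, hz⟩ v :=
      congrArg (fun f : TangentSpace 𝓘(ℝ, E') z [⋀^Fin (k + 1)]→L[ℝ] F ↦ f v)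
        (MForm.extendZero_apply_of_mem β hz)
    have e2 : mextDeriv δ.extendZero z v = mextDeriv δ ⟨z, hz⟩ v :=
      congrArg (fun f : TangentSpace 𝓘(ℝ, E') z [⋀^Fin (k + 1)]→L[ℝ] F ↦ f v)
        (MForm.mextDeriv_extendZero_apply_of_mem hz (hδ ⟨z, hz⟩))
    have e3 : β ⟨z, hz⟩ v - s z v = mextDeriv δ ⟨z, hz⟩ v := by
      have h1 := congrFun h ⟨z, hz⟩
      rw [Pi.sub_apply] at h1
      have h2 := DFunLike.congr_fun (α := Fin (k + 1) → TangentSpace 𝓘(ℝ, E') (⟨z, hz⟩ : W)) h1 v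
      rw [ContinuousAlternatingMap.sub_apply, MForm.pullback_subtypeVal_apply] at h2
      exact h2
    rw [Pi.sub_apply, ContinuousAlternatingMap.sub_apply, MForm.restr_apply_of_mem _ hz,
      ← neg_one_smul ℝ δ.extendZero, mextDeriv_smul, Pi.smul_apply,
      ContinuousAlternatingMap.smul_apply, e1, e2, ← e3, neg_one_smul, neg_sub]
  · rw [Pi.sub_apply, hs.2 z hz, MForm.extendZero_apply_of_notMem _ hz, sub_zero,
      MForm.restr_apply_of_notMem _ hz]

end Submanifold

end Literature.Geometry.Kaehler

namespace Literature.AlgebraicGeometry.HodgeTheory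

section HodgeTheory

variable {E : Type} [NormedAddCommGroup E] [NormedSpace ℂ E] [FiniteDimensional ℂ E] {m : ℕ}

/-- Sign bookkeeping: `(-1)^p • (-1)^p • y = y`. [folklore] -/
private theorem neg_one_pow_smul_neg_one_pow_smul {R : Type*} [Ring R] {V : Type*} [AddCommGroup V]
    [Module R V] (p : ℕ) (y : V) : ((-1 : R) ^ p) • ((-1 : R) ^ p) • y = y := by
  rw [smul_smul, ← pow_add, ← two_mul, pow_mul, neg_one_sq, one_pow, one_smul]

/-- Sign bookkeeping: `(-1)^p • y = 0` forces `y = 0`. [folklore] -/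
private theorem eq_zero_of_neg_one_pow_smul_eq_zero {R : Type*} [Ring R] {V : Type*} [AddCommGroup V]
    [Module R V] (p : ℕ) {y : V} (h : ((-1 : R) ^ p) • y = 0) : y = 0 := by
  rw [← neg_one_pow_smul_neg_one_pow_smul (R := R) p y, h, smul_zero]

namespace AnalyticModel

/-! ### Theorem 1′ on one affine scheme, read on cochains -/

section Model

variable {Y : Motives.SchemeOver ℂ} [IsAffine Y.left] (B : AnalyticModel E m Y) {N : ℕ}
  (x : Fin N → Γ(Y.left, ⊤)) {I : Ideal (MvPolynomial (Fin N) ℂ)}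
  (hI : I ≤ RingHom.ker (coordPresentation Y x))

/-- **Theorem 1′, injectivity, on cochains**: if the comparison map (5) of `Y` is injective in degree
`k`, a closed regular `k`-form whose holomorphic image is an exact smooth form on `Y^an` is exact.
[cite: Grothendieck1966, Thm. 1′] -/
theorem mem_exactForms_of_regularFormRealize_mem_cexactSmoothForms {k : ℕ}
    (hinj : Injective (deRhamComparison B x hI k)) {r : RegularForm I k} (hr : r ∈ closedForms I k)
    (h : regularFormRealize B x hI k r ∈ cexactSmoothForms E B.carrier k) : r ∈ exactForms I k := by
  refine (DeRhamCohomology.mk_eq_zero_iff I ⟨r, hr⟩).1 (hinj ?_)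
  rw [map_zero, deRhamComparison_mk, ← map_zero (complexDeRhamCohomology.mk E B.carrier k),
    complexDeRhamCohomology.mk_eq_mk_iff, Submodule.coe_zero, sub_zero]
  exact h

/-- **Theorem 1′, surjectivity, on cochains**: if the comparison map (5) of `Y` is onto in degree
`k`, every closed smooth complex `k`-form on `Y^an` is, up to an exact smooth form, the holomorphic
image of a closed regular `k`-form. [cite: Grothendieck1966, Thm. 1′] -/
theorem exists_regularFormRealize_sub_mem_cexactSmoothForms {k : ℕ}
    (hsurj : Surjective (deRhamComparison B x hI k)) {γ : MForm 𝓘(ℝ, E) B.carrier ℂ k}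
    (hγ : γ ∈ cclosedSmoothForms E B.carrier k) :
    ∃ r : RegularForm I k, r ∈ closedForms I k ∧
      regularFormRealize B x hI k r - γ ∈ cexactSmoothForms E B.carrier k := by
  obtain ⟨ξ, hξ⟩ := hsurj (complexDeRhamCohomology.mk E B.carrier k ⟨γ, hγ⟩)
  obtain ⟨r, rfl⟩ := DeRhamCohomology.mk_surjective I ξ
  refine ⟨r, r.2, ?_⟩
  rw [deRhamComparison_mk, complexDeRhamCohomology.mk_eq_mk_iff] at hξ
  exact hξ

end Model

/-! ### Theorem 1′ on an affine open piece, read on the local forms of `X^an` -/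

section Piece

variable {Y : Motives.SchemeOver ℂ} (A : AnalyticModel E m Y) {O : Y.left.Opens}
  [IsAffine (Motives.openSubschemeOver Y O).left] {N : ℕ}
  (x : Fin N → Γ((Motives.openSubschemeOver Y O).left, ⊤))
  {I : Ideal (MvPolynomial (Fin N) ℂ)}
  (hI : I ≤ RingHom.ker (coordPresentation (Motives.openSubschemeOver Y O) x))

/-- **Injectivity in degree `0` on the piece**: if (5) of `O` is injective in degree `0`, a closed
regular `0`-form on `O` whose holomorphic image, extended by zero to `Y^an`, vanishes is zero.
[cite: Grothendieck1966, Thm. 1′] -/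
theorem eq_zero_of_realizeOn_eq_zero (hinj : Injective (deRhamComparison (A.restrictOpen O) x hI 0))
    {r : RegularForm I 0} (hr : RegularForm.d I r = 0) (h : A.realizeOn x hI 0 r = 0) : r = 0 := by
  have hmem : regularFormRealize (A.restrictOpen O) x hI 0 r ∈
      cexactSmoothForms E (A.restrictOpen O).carrier 0 := by
    rw [← A.pullback_subtypeVal_realizeOn x hI 0 r, h, MForm.pullback_zero]
    exact zero_mem _
  have hex := (A.restrictOpen O).mem_exactForms_of_regularFormRealize_mem_cexactSmoothForms x hI hinj
    (LinearMap.mem_ker.2 hr) hmem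
  change r ∈ (⊥ : Submodule ℂ (RegularForm I 0)) at hex
  exact (Submodule.mem_bot ℂ).1 hex

/-- **Injectivity in positive degree on the piece**: if (5) of `O` is injective in degree `k + 1`, a
closed regular `(k+1)`-form on `O` whose holomorphic image, extended by zero, is `d_W` of a local
`k`-form on the open piece `W = ψ⁻¹ O(ℂ)`, is `d` of a regular `k`-form.
[cite: Grothendieck1966, Thm. 1′] -/
theorem exists_d_eq_of_realizeOn_eq_restr_mextDeriv {k : ℕ}
    (hinj : Injective (deRhamComparison (A.restrictOpen O) x hI (k + 1)))
    {r : RegularForm I (k + 1)} (hr : RegularForm.d I r = 0)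
    {t : MForm 𝓘(ℝ, E) A.carrier ℂ k}
    (ht : t ∈ smoothFormsOn 𝓘(ℝ, E) ℂ (A.openSet O : Set A.carrier) k)
    (h : A.realizeOn x hI (k + 1) r = (mextDeriv t).restr (A.openSet O : Set A.carrier)) :
    ∃ r' : RegularForm I k, RegularForm.d I r' = r := by
  have hmem : regularFormRealize (A.restrictOpen O) x hI (k + 1) r ∈
      cexactSmoothForms E (A.restrictOpen O).carrier (k + 1) := by
    rw [mem_cexactSmoothForms_succ_iff]
    refine ⟨t.pullback 𝓘(ℝ, E) (Subtype.val : A.openSet O → A.carrier),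
      isSmoothForm_pullback_subtypeVal_of_mem_smoothFormsOn ht, ?_⟩
    -- read the goal on the open submanifold `↥(A.openSet O)` (the carrier of `A.restrictOpen O`)
    change regularFormRealize (A.restrictOpen O) x hI (k + 1) r =
      mextDeriv (t.pullback 𝓘(ℝ, E) (Subtype.val : A.openSet O → A.carrier))
    rw [← A.pullback_subtypeVal_realizeOn x hI (k + 1) r, h,
      mextDeriv_pullback_subtypeVal_of_mem_smoothFormsOn ht]
  have hex := (A.restrictOpen O).mem_exactForms_of_regularFormRealize_mem_cexactSmoothForms x hI hinj
    (LinearMap.mem_ker.2 hr) hmem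
  exact LinearMap.mem_range.1 hex

omit [IsAffine (Motives.openSubschemeOver Y O).left] in
/-- A `d_W`-closed local form on the open piece `W = ψ⁻¹ O(ℂ)`, restricted to the open submanifold
`↥W` (the carrier of `A.restrictOpen O`), is a closed smooth form. [cite: WarnerGTM94, Prop. 2.23] -/
theorem pullback_subtypeVal_mem_cclosedSmoothForms {k : ℕ} {s : MForm 𝓘(ℝ, E) A.carrier ℂ k}
    (hs : s ∈ smoothFormsOn 𝓘(ℝ, E) ℂ (A.openSet O : Set A.carrier) k)
    (hds : (mextDeriv s).restr (A.openSet O : Set A.carrier) = 0) :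
    s.pullback 𝓘(ℝ, E) (Subtype.val : A.openSet O → A.carrier) ∈
      cclosedSmoothForms E (A.restrictOpen O).carrier k := by
  refine mem_cclosedSmoothForms (isSmoothForm_pullback_subtypeVal_of_mem_smoothFormsOn hs) ?_
  change mextDeriv (s.pullback 𝓘(ℝ, E) (Subtype.val : A.openSet O → A.carrier)) = 0
  rw [mextDeriv_pullback_subtypeVal_of_mem_smoothFormsOn hs, hds, MForm.pullback_zero]

/-- **Surjectivity in degree `0` on the piece**: if (5) of `O` is onto in degree `0`, every
`d_W`-closed local `0`-form on the open piece is the holomorphic image of a closed regular `0`-form.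
[cite: Grothendieck1966, Thm. 1′] -/
theorem exists_eq_realizeOn_of_restr_mextDeriv_eq_zero
    (hsurj : Surjective (deRhamComparison (A.restrictOpen O) x hI 0))
    {s : MForm 𝓘(ℝ, E) A.carrier ℂ 0}
    (hs : s ∈ smoothFormsOn 𝓘(ℝ, E) ℂ (A.openSet O : Set A.carrier) 0)
    (hds : (mextDeriv s).restr (A.openSet O : Set A.carrier) = 0) :
    ∃ r : RegularForm I 0, RegularForm.d I r = 0 ∧ s = A.realizeOn x hI 0 r := by
  obtain ⟨r, hr, hex⟩ := (A.restrictOpen O).exists_regularFormRealize_sub_mem_cexactSmoothForms x hI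
    hsurj (A.pullback_subtypeVal_mem_cclosedSmoothForms hs hds)
  refine ⟨r, LinearMap.mem_ker.1 hr, ?_⟩
  change _ ∈ (⊥ : Submodule ℂ _) at hex
  rw [Submodule.mem_bot, sub_eq_zero] at hex
  rw [A.realizeOn_apply x hI 0 r, hex, MForm.extendZero_pullback_subtypeVal, restr_eq_self_of_mem hs]

/-- **Surjectivity in positive degree on the piece**: if (5) of `O` is onto in degree `k + 1`, every
`d_W`-closed local `(k+1)`-form on the open piece `W = ψ⁻¹ O(ℂ)` is the holomorphic image of a closed
regular form plus `d_W` of a local `k`-form. [cite: Grothendieck1966, Thm. 1′] -/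
theorem exists_sub_realizeOn_eq_restr_mextDeriv {k : ℕ}
    (hsurj : Surjective (deRhamComparison (A.restrictOpen O) x hI (k + 1)))
    {s : MForm 𝓘(ℝ, E) A.carrier ℂ (k + 1)}
    (hs : s ∈ smoothFormsOn 𝓘(ℝ, E) ℂ (A.openSet O : Set A.carrier) (k + 1))
    (hds : (mextDeriv s).restr (A.openSet O : Set A.carrier) = 0) :
    ∃ r : RegularForm I (k + 1), RegularForm.d I r = 0 ∧
      ∃ t ∈ smoothFormsOn 𝓘(ℝ, E) ℂ (A.openSet O : Set A.carrier) k,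
        s - A.realizeOn x hI (k + 1) r = (mextDeriv t).restr (A.openSet O : Set A.carrier) := by
  obtain ⟨r, hr, hex⟩ := (A.restrictOpen O).exists_regularFormRealize_sub_mem_cexactSmoothForms x hI
    hsurj (A.pullback_subtypeVal_mem_cclosedSmoothForms hs hds)
  obtain ⟨δ, hδ, hδeq⟩ := (mem_cexactSmoothForms_succ_iff _).1 hex
  refine ⟨r, LinearMap.mem_ker.1 hr, -MForm.extendZero (U := A.openSet O) δ,
    neg_mem (MForm.extendZero_mem_smoothFormsOn hδ), ?_⟩
  rw [A.realizeOn_apply x hI (k + 1) r]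
  exact sub_extendZero_eq_restr_mextDeriv hδ hs hδeq

end Piece

end AnalyticModel

/-! ### The columns of the realisation morphism are quasi-isomorphisms -/

namespace CoverCharts

variable {X : Motives.SchemeOver ℂ} {ι : Type u} {U : ι → X.left.Opens} (C : CoverCharts X U)
  (A : AnalyticModel E m X) [IsAffineCover U] [SmoothOfRelativeDimension m X.hom]

/-- **The `p`-th column of the realisation morphism is a quasi-isomorphism** when Theorem 1′ holds
for every finite intersection `U_J`: the column is the product over the `(p+1)`-tuples `J` of the
comparison cochain maps `Ω•(U_J) → Ω•(ψ⁻¹U_J(ℂ))` (up to the sign `(-1)^p` of the vertical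
differentials), each a quasi-isomorphism by the piece lemmas — Grothendieck's "isomorphisms for
the terms `E₂` … if (5) is an isomorphism when `X` is replaced by `U_{i₀} ∩ … ∩ U_{i_p}`", on the
`E₁`-page. [cite: Grothendieck1966, p. 96–97 (6)] -/
theorem bijective_cohomologyMap_realize_of_forall_deRhamComparison_bijective
    (h : ∀ {p : ℕ} (J : Fin (p + 1) → ι) (k : ℕ),
      Bijective (deRhamComparison (A.restrictOpen (cechOpen U J)) (C.coord J) (le_refl (C.ideal J)) k))
    (p q : ℕ) :
    Bijective (NatCochain.Cohomology.map (d := fun j ↦ C.cechDeRhamℝ.d p j)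
      (d' := fun j ↦ (Literature.Geometry.Kaehler.cechDeRham 𝓘(ℝ, E) ℂ (A.isOpen_coverSet U)).d p j)
      (fun j ↦ (C.realizeHom A).f p j) (fun j c ↦ (C.realizeHom A).f_d p j c) q) := by
  -- the open pieces of the finite intersections
  have hW : ∀ J : Fin (p + 1) → ι,
      cechSet (A.coverSet U) J = (A.openSet (cechOpen U J) : Set A.carrier) :=
    fun J ↦ A.cechSet_coverSet U J
  constructor
  · -- injectivity
    rw [NatCochain.Cohomology.injective_map_iff]
    intro c hc hfc
    have hc' : C.cechd p q c = 0 := (NatCochain.mem_cocycles_iff _).1 hc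
    have hdJ : ∀ J, RegularForm.d (C.ideal J) (c J) = 0 := fun J ↦
      eq_zero_of_neg_one_pow_smul_eq_zero (R := ℂ) p (by rw [← C.cechd_apply c J]; exact congrFun hc' J)
    cases q with
    | zero =>
      rw [NatCochain.coboundaries_zero, Submodule.mem_bot] at hfc ⊢
      funext J
      have h0 : A.realizeOn (C.coord J) le_rfl 0 (c J) = 0 :=
        congrArg (fun f : smoothFormsOn 𝓘(ℝ, E) ℂ (cechSet (A.coverSet U) J) 0 ↦
          (f : MForm 𝓘(ℝ, E) A.carrier ℂ 0)) (congrFun hfc J)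
      exact A.eq_zero_of_realizeOn_eq_zero (C.coord J) le_rfl (h J 0).1 (hdJ J) h0
    | succ q =>
      obtain ⟨s, hs⟩ := (NatCochain.mem_coboundaries_succ_iff _).1 hfc
      change Literature.Geometry.Kaehler.cechd 𝓘(ℝ, E) ℂ (A.isOpen_coverSet U) p q s =
        C.realize A p (q + 1) c at hs
      have hr' : ∀ J, ∃ r' : RegularForm (C.ideal J) q, RegularForm.d (C.ideal J) r' = c J := by
        intro J
        have hsJ : ((-1 : ℝ) ^ p • (s J : MForm 𝓘(ℝ, E) A.carrier ℂ q)) ∈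
            smoothFormsOn 𝓘(ℝ, E) ℂ (A.openSet (cechOpen U J) : Set A.carrier) q := by
          rw [← hW J]
          exact Submodule.smul_mem _ _ (s J).2
        refine A.exists_d_eq_of_realizeOn_eq_restr_mextDeriv (C.coord J) le_rfl (h J (q + 1)).1
          (hdJ J) hsJ ?_
        rw [← C.coe_realize_apply A p (q + 1) c J, ← hs, Literature.Geometry.Kaehler.cechd_apply,
          Submodule.coe_smul, coe_localD, mextDeriv_smul, MForm.restr_smul]
        exact congrArg (fun S : Set A.carrier ↦
          ((-1 : ℝ) ^ p) • (mextDeriv (s J : MForm 𝓘(ℝ, E) A.carrier ℂ q)).restr S) (hW J)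
      choose r' hr' using hr'
      refine (NatCochain.mem_coboundaries_succ_iff _).2 ⟨fun J ↦ (-1 : ℂ) ^ p • r' J, ?_⟩
      funext J
      change C.cechd p q (fun J ↦ (-1 : ℂ) ^ p • r' J) J = c J
      rw [C.cechd_apply, map_smul, neg_one_pow_smul_neg_one_pow_smul, hr']
  · -- surjectivity
    rw [NatCochain.Cohomology.surjective_map_iff]
    intro c' hc'
    have hc'' : Literature.Geometry.Kaehler.cechd 𝓘(ℝ, E) ℂ (A.isOpen_coverSet U) p q c' = 0 :=
      (NatCochain.mem_cocycles_iff _).1 hc'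
    have hsJ : ∀ J, (c' J : MForm 𝓘(ℝ, E) A.carrier ℂ q) ∈
        smoothFormsOn 𝓘(ℝ, E) ℂ (A.openSet (cechOpen U J) : Set A.carrier) q := fun J ↦ by
      rw [← hW J]
      exact (c' J).2
    have hdsJ : ∀ J, (mextDeriv (c' J : MForm 𝓘(ℝ, E) A.carrier ℂ q)).restr
        (A.openSet (cechOpen U J) : Set A.carrier) = 0 := fun J ↦ by
      have h0 : localD 𝓘(ℝ, E) ℂ q (isOpen_cechSet (A.isOpen_coverSet U) J) (c' J) = 0 :=
        eq_zero_of_neg_one_pow_smul_eq_zero (R := ℝ) p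
          (by rw [← Literature.Geometry.Kaehler.cechd_apply]; exact congrFun hc'' J)
      rw [← hW J, ← coe_localD (isOpen_cechSet (A.isOpen_coverSet U) J) (c' J), h0]
      rfl
    cases q with
    | zero =>
      have hr : ∀ J, ∃ r : RegularForm (C.ideal J) 0, RegularForm.d (C.ideal J) r = 0 ∧
          (c' J : MForm 𝓘(ℝ, E) A.carrier ℂ 0) = A.realizeOn (C.coord J) le_rfl 0 r := fun J ↦
        A.exists_eq_realizeOn_of_restr_mextDeriv_eq_zero (C.coord J) le_rfl (h J 0).2 (hsJ J) (hdsJ J)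
      choose r hr heq using hr
      refine ⟨r, (NatCochain.mem_cocycles_iff _).2 ?_, ?_⟩
      · funext J
        change C.cechd p 0 r J = 0
        rw [C.cechd_apply, hr, smul_zero]
      · rw [NatCochain.coboundaries_zero, Submodule.mem_bot, sub_eq_zero]
        funext J
        exact Subtype.ext (heq J)
    | succ q =>
      have hr : ∀ J, ∃ r : RegularForm (C.ideal J) (q + 1), RegularForm.d (C.ideal J) r = 0 ∧
          ∃ t ∈ smoothFormsOn 𝓘(ℝ, E) ℂ (A.openSet (cechOpen U J) : Set A.carrier) q,
            (c' J : MForm 𝓘(ℝ, E) A.carrier ℂ (q + 1)) - A.realizeOn (C.coord J) le_rfl (q + 1) r =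
              (mextDeriv t).restr (A.openSet (cechOpen U J) : Set A.carrier) := fun J ↦
        A.exists_sub_realizeOn_eq_restr_mextDeriv (C.coord J) le_rfl (h J (q + 1)).2 (hsJ J) (hdsJ J)
      choose r hr t ht heq using hr
      refine ⟨r, (NatCochain.mem_cocycles_iff _).2 ?_, ?_⟩
      · funext J
        change C.cechd p (q + 1) r J = 0
        rw [C.cechd_apply, hr, smul_zero]
      · refine (NatCochain.mem_coboundaries_succ_iff _).2
          ⟨fun J ↦ (-1 : ℝ) ^ p • ⟨t J, by rw [hW J]; exact ht J⟩, ?_⟩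
        funext J
        apply Subtype.ext
        simp only [Literature.Geometry.Kaehler.cechDeRham, CoverCharts.realizeHom, Pi.sub_apply,
          Submodule.coe_sub, CoverCharts.coe_realize_apply, Literature.Geometry.Kaehler.cechd_apply,
          Submodule.coe_smul, coe_localD, mextDeriv_smul, MForm.restr_smul,
          neg_one_pow_smul_neg_one_pow_smul, heq J, hW J]

/-- **Grothendieck's reduction of Theorem 1′ to the affine pieces** [Grothendieck1966, p. 96–97 (6)]:
if the comparison map (5) `deRhamComparison` is bijective for every finite intersection `U_J` of the
affine cover `𝔘` (on the analytic models `A.restrictOpen U_J`, with the charts `C.coord J`) and every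
degree, then the realisation `Hⁿ(Tot Č(𝔘, Ω•_alg)) → Hⁿ(Tot Č(𝔘^an, Ω))` is bijective for every
`n` — the columns of the morphism of double complexes `realizeHom` are quasi-isomorphisms, hence so
is the map of total complexes ([KashiwaraSchapira2006, Thm. 12.5.4], the `E₁`-form of the
homomorphism of the spectral sequences (6)). [cite: Grothendieck1966, p. 96–97 (6)] -/
theorem bijective_realizeTotCohMap_of_forall_deRhamComparison_bijective
    (h : ∀ {p : ℕ} (J : Fin (p + 1) → ι) (k : ℕ),
      Bijective (deRhamComparison (A.restrictOpen (cechOpen U J)) (C.coord J) (le_refl (C.ideal J)) k))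
    (n : ℕ) : Bijective (C.realizeTotCohMap A n) :=
  (C.realizeHom A).bijective_totCohMap_of_cols
    (fun p q ↦ C.bijective_cohomologyMap_realize_of_forall_deRhamComparison_bijective A h p q) n

/-- **Theorem 1′ for `X` along a finite affine cover, from Theorem 1′ on its pieces**: for a finite
cover `⋃ U_i = X` the realisation map of Route P
`realizeDeRham : Hⁿ(Tot Č(𝔘, Ω•_alg)) → Hⁿ(Ω•(X^an), d)` (the map on total cohomology followed by the
partition-of-unity edge isomorphism) is bijective. [cite: Grothendieck1966, p. 96–97 (6)]
[cite: CattaniElZeinGriffithsLe2014, Ch. 2 §2.9.2 (p. 109)] -/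
theorem bijective_realizeDeRham_of_forall_deRhamComparison_bijective [Fintype ι] (hU : ⨆ i, U i = ⊤)
    (h : ∀ {p : ℕ} (J : Fin (p + 1) → ι) (k : ℕ),
      Bijective (deRhamComparison (A.restrictOpen (cechOpen U J)) (C.coord J) (le_refl (C.ideal J)) k))
    (n : ℕ) : Bijective (C.realizeDeRham A hU n) := by
  rw [CoverCharts.realizeDeRham, LinearMap.coe_comp]
  exact (LinearEquiv.bijective _).comp
    (C.bijective_realizeTotCohMap_of_forall_deRhamComparison_bijective A h n)

end CoverCharts

/-! ### Conjugate classes on a smooth projective `X` from Theorem 1′ on the pieces of an affine cover -/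

/-- **Conjugate classes from Theorem 1′ on the affine pieces.** Let `X` be smooth projective over `ℂ`
with a finite affine open cover `𝔘` (charts `C`) and an analytic model `A`. If Grothendieck's
comparison map (5) is bijective for every finite intersection `U_J` of `𝔘` and every degree
(Theorem 1′ for the finitely many affine schemes `U_J`), then for every `σ ∈ Aut ℂ`, every `k` and
every `c ∈ Hᵏ(X(ℂ); ℂ)` there is a class `c' ∈ Hᵏ(X^σ(ℂ); ℂ)` conjugate to `c` (`IsConjugateClass`,
the existence conjunct of `IsAbsoluteHodgeClass`): Grothendieck's reduction to the pieces
[Grothendieck1966, p. 96–97 (6)] makes the realisation map onto, and the torsor step of Route P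
(`exists_isConjugateClass_of_surjective_realizeDeRham`, [CharlesSchnell2014Notes, §11.2.2 (11.2.3)]
on Jouanolou's affine) concludes — without the named fact (G) for all smooth affine `Y`.
[cite: Grothendieck1966, p. 96–97 (6)] [cite: CharlesSchnell2014Notes, §11.2.2 (11.2.3)] -/
theorem exists_isConjugateClass_of_forall_deRhamComparison_bijective {n : ℕ} {X : Motives.SchemeOver ℂ}
    {ι : Type u} {U : ι → X.left.Opens} (hX : Motives.IsSmoothProjective n X) [Fintype ι]
    [IsAffineCover U] (hU : ⨆ i, U i = ⊤) (C : CoverCharts X U) (A : AnalyticModel E n X)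
    (h : ∀ {p : ℕ} (J : Fin (p + 1) → ι) (k : ℕ),
      Bijective (deRhamComparison (A.restrictOpen (cechOpen U J)) (C.coord J) (le_refl (C.ideal J)) k))
    (k : ℕ) (σ : ℂ ≃+* ℂ) (c : complexBetti X k) : ∃ c', IsConjugateClass σ X k c c' := by
  haveI : SmoothOfRelativeDimension n X.hom := hX.smoothOfRelativeDimension
  refine exists_isConjugateClass_of_surjective_realizeDeRham hX hU C A k ?_ σ c
  exact (localCohomologyEquivComplexDeRham k).surjective.comp
    (C.bijective_realizeDeRham_of_forall_deRhamComparison_bijective A hU h k).2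

end HodgeTheory

end Literature.AlgebraicGeometry.HodgeTheory

end
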